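import Literature.MathematicalPhysics.QuantumFieldTheory.Balaban1983to89.BalabanAdmissibleClassParams
import Literature.MathematicalPhysics.QuantumFieldTheory.Balaban1983to89.T4CubeChartExp
import Mathlib.Analysis.Complex.Schwarz
import HarnessLib

/-!
# Crux `FluctuationComparisonRegPrIntL` (stmt-QuantumFields-20520, rung R3), PATH-B organ, v18 (H-currency): BRICK GA —
# GRADIENT LETTERS FROM THE ANALYTICITY CLAUSE (β): `|f(U·e^w@b) − f(U)| ≤ (B∕r)·(‖w‖∕θ)` by the Schwarz lemma (DEFINITION-FREE)

Cell `ym3-torus` (YM ladder rung R3 = continuum `SU(2)` Yang–Mills on the three-torus — a RUNG: NOT d = 4, NOT infinite volume, NOT a mass gap, NOT Clay).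
LEAD-20520 width seat `ym-ust-20520-w3` (gen 25); `--kind proof --supports stmt-QuantumFields-20520 --as helper`, count-neutral, no registry ∕ binder ∕ `Lines/` edit,
default heartbeats, `autoImplicit false`.

WHAT THIS IS.  The v18 frame (O1ᵘ-H v2 ∕ S3ᴴ block ⑧, S1aᴴ) carries at every height the analyticity predicate (β) `AnalyticPairWindowAt θ r B f` (LEAD w3 g24 spec §1;
`Cruxes/…/V18DraftTexts.lean` v0.3): on the `θ`-window, the two-bond trace `(s,t) ↦ f(U·e^{s v}@b·e^{t v′}@b′)` of `f` is the real trace of a holomorphic `g` on the bidisc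
of radius `r·θ` with oscillation `‖g z − g 0‖ ≤ B`.  ✓p794976 (`…OrganTangentBidiscMixedDifference`) turned this into SECOND-difference (H-) letters `8B∕r²`.  THIS FILE gives
the FIRST-difference (gradient) letters, which BRICK 2a's pull-back (✓p805782, hypothesis `hG`) and BRICK 2b∕3's cross∕centred channels consume:
★★`firstDiff_of_analyticPairWindowAt` — with the (β) TEXT carried VERBATIM as hypothesis (inlined, def-free), for `U` in the `θ`-window, a bond `b` and a move `w` with
`‖w‖ < r·θ`: `|f V − f U| ≤ (B∕r)·(‖w‖∕θ)` for the one-bond right exponential move `V` (`V e = U e` off `b`, `V b = U b·expPt w`); `_update` edition.  PROOF: restrict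
`g` to the slice `t = 0` (`expPt 0 = 1` makes `Z = V`), a holomorphic self-map of the disc of radius `r·θ` into the closed `B`-ball about `g 0 = f U`; the Schwarz lemma
(Mathlib `Complex.dist_le_div_mul_dist_of_mapsTo_ball`) gives `|g(s,0) − g(0,0)| ≤ (B∕(rθ))·|s|` at `s = ‖w‖`, direction `w∕‖w‖`.  So in the v18 frame the gradient
letters of `log ρ_j`, `log ρ′_j` on the `θBal_j∕2`-window are `g_b = Bρ j ∕ rA` UNIFORMLY in the bond (a profile in the height, no volume factor) — the `hG` slot of 2a.

HONEST FRAMING: one-variable complex analysis over a HYPOTHESIS predicate; whether the runs' densities satisfy (β) is print's claim ([Balaban1985UV3] p.263 (c)), not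
formalised (S1aᴴ, L); nothing of Bałaban's renormalisation-group analysis is asserted or proved; LINᵘ-H ∕ JVARᵘ-H ∕ O1ᵘ-H v2 ∕ S1aᴴ ∕ 26243 ∕ S2α′ ∕ S2β OPEN; crux 20520
`FluctuationComparisonRegPrIntL` ∕ `YM3TorusSU2` NOT proved; no summit ∕ sub-problem statement is proved; rung R3 = SU(2) YM₃ on T³ at fixed lattice data — NOT d = 4, NOT
infinite volume, NOT a mass gap, NOT Clay; the Yang–Mills mass gap is NOT proved.  [folklore] Schwarz lemma; [cite: Balaban1985UV3, p.263 (c)] for the predicate's origin.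
-/

set_option autoImplicit false

noncomputable section

namespace Summit.QuantumFields.YangMills.Theorems.OrganTangentGradientFromAnalytic

open Metric Set Function
open Literature.MathematicalPhysics.QuantumFieldTheory.Balaban1983to89 T3ContinuumYM3Torus T3NestedUnitLaws
  T3UnitLawDensityEML T4Continuum BalabanUVClass T3UnitScaleTilt
open T4CubeChartExp (expPt expPt_zero)

variable {P : Params} {j : ℕ}

/-- ★★ **GRADIENT LETTERS FROM (β)**: the analyticity predicate `AnalyticPairWindowAt θ r B f` (text VERBATIM as hypothesis `hβ`) gives, at every `θ`-window
configuration, every bond and every move `w` with `‖w‖ < r·θ`, the first-difference bound `|f V − f U| ≤ (B∕r)·(‖w‖∕θ)` (relational form). [folklore] -/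
theorem firstDiff_of_analyticPairWindowAt (θ r B : ℝ) (hθ : 0 < θ) (hr : 0 < r)
    (f : GaugeField P j ↥(Matrix.specialUnitaryGroup (Fin 2) ℂ) → ℝ)
    (hβ : ∀ (U : GaugeField P j ↥(Matrix.specialUnitaryGroup (Fin 2) ℂ)), PlaqSmall θ U →
      ∀ (b b' : PBond P j) (v v' : Fin 3 → ℝ), ‖v‖ ≤ 1 → ‖v'‖ ≤ 1 →
        ∃ g : ℂ × ℂ → ℂ, DifferentiableOn ℂ g (Metric.ball (0 : ℂ) (r * θ) ×ˢ Metric.ball (0 : ℂ) (r * θ)) ∧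
          (∀ (s t : ℝ) (V Z : GaugeField P j ↥(Matrix.specialUnitaryGroup (Fin 2) ℂ)), |s| < r * θ → |t| < r * θ →
            (∀ e, e ≠ b → V e = U e) → V b = U b * expPt (s • v) → (∀ e, e ≠ b' → Z e = V e) → Z b' = V b' * expPt (t • v') →
            g ((s : ℂ), (t : ℂ)) = ((f Z : ℝ) : ℂ)) ∧
          ∀ z ∈ Metric.ball (0 : ℂ) (r * θ) ×ˢ Metric.ball (0 : ℂ) (r * θ), ‖g z - g 0‖ ≤ B)
    (U : GaugeField P j ↥(Matrix.specialUnitaryGroup (Fin 2) ℂ)) (hU : PlaqSmall θ U) (b : PBond P j) (w : Fin 3 → ℝ) (hw : ‖w‖ < r * θ)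
    (V : GaugeField P j ↥(Matrix.specialUnitaryGroup (Fin 2) ℂ)) (hVe : ∀ e, e ≠ b → V e = U e) (hVb : V b = U b * expPt w) :
    |f V - f U| ≤ (B / r) * (‖w‖ / θ) := by
  have hρ : 0 < r * θ := mul_pos hr hθ
  by_cases hw0 : w = 0
  · -- the move is trivial: `V = U`
    subst hw0
    have hVU : V = U := by
      funext e
      by_cases he : e = b
      · subst he; rw [hVb, expPt_zero, mul_one]
      · exact hVe e he
    rw [hVU, sub_self, abs_zero, norm_zero, zero_div, mul_zero]
  · -- direction `v := ‖w‖⁻¹ • w`, size `s := ‖w‖`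
    have hnw : 0 < ‖w‖ := norm_pos_iff.mpr hw0
    set v : Fin 3 → ℝ := ‖w‖⁻¹ • w with hv
    have hv1 : ‖v‖ ≤ 1 := by
      rw [hv, norm_smul, norm_inv, norm_norm, inv_mul_cancel₀ hnw.ne']
    have hsv : ‖w‖ • v = w := by rw [hv, smul_smul, mul_inv_cancel₀ hnw.ne', one_smul]
    obtain ⟨g, hgd, hgtr, hgB⟩ := hβ U hU b b v v hv1 hv1
    -- the base value `g 0 = f U` and the moved value `g (‖w‖, 0) = f V`
    have h0 : g (((0 : ℝ) : ℂ), ((0 : ℝ) : ℂ)) = ((f U : ℝ) : ℂ) := by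
      refine hgtr 0 0 U U (by simpa using hρ) (by simpa using hρ) (fun e _ => rfl) ?_ (fun e _ => rfl) ?_
      · rw [zero_smul, expPt_zero, mul_one]
      · rw [zero_smul, expPt_zero, mul_one]
    have h1 : g (((‖w‖ : ℝ) : ℂ), ((0 : ℝ) : ℂ)) = ((f V : ℝ) : ℂ) := by
      refine hgtr ‖w‖ 0 V V (by rw [abs_of_pos hnw]; exact hw) (by simpa using hρ) hVe ?_ (fun e _ => rfl) ?_
      · rw [hsv]; exact hVb
      · rw [zero_smul, expPt_zero, mul_one]
    have h00 : ((0 : ℝ) : ℂ) = (0 : ℂ) := by simp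
    -- the slice `g₁ z := g (z, 0)` is holomorphic on the disc and maps it into the closed `B`-ball about `g₁ 0`
    set g₁ : ℂ → ℂ := fun z => g (z, 0) with hg₁
    have hincl : MapsTo (fun z : ℂ => (z, (0 : ℂ))) (ball (0 : ℂ) (r * θ)) (ball (0 : ℂ) (r * θ) ×ˢ ball (0 : ℂ) (r * θ)) := by
      intro z hz
      exact ⟨hz, by simpa using hρ⟩
    have hg₁d : DifferentiableOn ℂ g₁ (ball (0 : ℂ) (r * θ)) := by
      have hι : DifferentiableOn ℂ (fun z : ℂ => (z, (0 : ℂ))) (ball (0 : ℂ) (r * θ)) :=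
        (differentiable_id.prodMk (differentiable_const _)).differentiableOn
      exact hgd.comp hι hincl
    have hmaps : MapsTo g₁ (ball (0 : ℂ) (r * θ)) (closedBall (g₁ 0) B) := by
      intro z hz
      rw [mem_closedBall, dist_eq_norm]
      have hz2 : ((z, (0 : ℂ)) : ℂ × ℂ) ∈ ball (0 : ℂ) (r * θ) ×ˢ ball (0 : ℂ) (r * θ) := hincl hz
      have := hgB (z, 0) hz2
      simpa [hg₁, Prod.zero_eq_mk] using this
    have hsball : ((‖w‖ : ℝ) : ℂ) ∈ ball (0 : ℂ) (r * θ) := by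
      rw [mem_ball, dist_zero_right, Complex.norm_real, Real.norm_eq_abs, abs_of_pos hnw]
      exact hw
    have hschwarz := Complex.dist_le_div_mul_dist_of_mapsTo_ball hg₁d hmaps hsball
    -- read it on the real trace
    have hdist : dist (g₁ ((‖w‖ : ℝ) : ℂ)) (g₁ 0) = |f V - f U| := by
      have e1 : g₁ ((‖w‖ : ℝ) : ℂ) = ((f V : ℝ) : ℂ) := by rw [hg₁]; simpa [h00] using h1
      have e0 : g₁ 0 = ((f U : ℝ) : ℂ) := by rw [hg₁]; simpa [h00] using h0
      rw [e1, e0, dist_eq_norm, ← Complex.ofReal_sub, Complex.norm_real, Real.norm_eq_abs]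
    have hd0 : dist (((‖w‖ : ℝ) : ℂ)) (0 : ℂ) = ‖w‖ := by
      rw [dist_zero_right, Complex.norm_real, Real.norm_eq_abs, abs_of_pos hnw]
    rw [hdist, hd0] at hschwarz
    calc |f V - f U| ≤ B / (r * θ) * ‖w‖ := hschwarz
      _ = (B / r) * (‖w‖ / θ) := by field_simp

/-- The `Function.update` edition of ★★`firstDiff_of_analyticPairWindowAt` (with the consumer's `DecidableEq (PBond P j)` instance, as brick T). [folklore] -/
theorem firstDiff_update_of_analyticPairWindowAt [DecidableEq (PBond P j)] (θ r B : ℝ) (hθ : 0 < θ) (hr : 0 < r)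
    (f : GaugeField P j ↥(Matrix.specialUnitaryGroup (Fin 2) ℂ) → ℝ)
    (hβ : ∀ (U : GaugeField P j ↥(Matrix.specialUnitaryGroup (Fin 2) ℂ)), PlaqSmall θ U →
      ∀ (b b' : PBond P j) (v v' : Fin 3 → ℝ), ‖v‖ ≤ 1 → ‖v'‖ ≤ 1 →
        ∃ g : ℂ × ℂ → ℂ, DifferentiableOn ℂ g (Metric.ball (0 : ℂ) (r * θ) ×ˢ Metric.ball (0 : ℂ) (r * θ)) ∧
          (∀ (s t : ℝ) (V Z : GaugeField P j ↥(Matrix.specialUnitaryGroup (Fin 2) ℂ)), |s| < r * θ → |t| < r * θ →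
            (∀ e, e ≠ b → V e = U e) → V b = U b * expPt (s • v) → (∀ e, e ≠ b' → Z e = V e) → Z b' = V b' * expPt (t • v') →
            g ((s : ℂ), (t : ℂ)) = ((f Z : ℝ) : ℂ)) ∧
          ∀ z ∈ Metric.ball (0 : ℂ) (r * θ) ×ˢ Metric.ball (0 : ℂ) (r * θ), ‖g z - g 0‖ ≤ B)
    (U : GaugeField P j ↥(Matrix.specialUnitaryGroup (Fin 2) ℂ)) (hU : PlaqSmall θ U) (b : PBond P j) (w : Fin 3 → ℝ) (hw : ‖w‖ < r * θ) :
    |f (update U b (U b * expPt w)) - f U| ≤ (B / r) * (‖w‖ / θ) :=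
  firstDiff_of_analyticPairWindowAt θ r B hθ hr f hβ U hU b w hw (update U b (U b * expPt w))
    (fun _ he => update_of_ne he _ _) (update_self _ _ _)

/-- `0 ≤ B` is automatic from the predicate at any window configuration (the bidisc contains `0`). [folklore] -/
theorem analyticPairWindowAt_bound_nonneg (θ r B : ℝ) (hθ : 0 < θ) (hr : 0 < r)
    (f : GaugeField P j ↥(Matrix.specialUnitaryGroup (Fin 2) ℂ) → ℝ)
    (hβ : ∀ (U : GaugeField P j ↥(Matrix.specialUnitaryGroup (Fin 2) ℂ)), PlaqSmall θ U →
      ∀ (b b' : PBond P j) (v v' : Fin 3 → ℝ), ‖v‖ ≤ 1 → ‖v'‖ ≤ 1 →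
        ∃ g : ℂ × ℂ → ℂ, DifferentiableOn ℂ g (Metric.ball (0 : ℂ) (r * θ) ×ˢ Metric.ball (0 : ℂ) (r * θ)) ∧
          (∀ (s t : ℝ) (V Z : GaugeField P j ↥(Matrix.specialUnitaryGroup (Fin 2) ℂ)), |s| < r * θ → |t| < r * θ →
            (∀ e, e ≠ b → V e = U e) → V b = U b * expPt (s • v) → (∀ e, e ≠ b' → Z e = V e) → Z b' = V b' * expPt (t • v') →
            g ((s : ℂ), (t : ℂ)) = ((f Z : ℝ) : ℂ)) ∧
          ∀ z ∈ Metric.ball (0 : ℂ) (r * θ) ×ˢ Metric.ball (0 : ℂ) (r * θ), ‖g z - g 0‖ ≤ B)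
    (U : GaugeField P j ↥(Matrix.specialUnitaryGroup (Fin 2) ℂ)) (hU : PlaqSmall θ U) (b : PBond P j) : 0 ≤ B := by
  have hρ : 0 < r * θ := mul_pos hr hθ
  obtain ⟨g, _, _, hgB⟩ := hβ U hU b b 0 0 (by simp) (by simp)
  have h := hgB (0 : ℂ × ℂ) ⟨by simpa using hρ, by simpa using hρ⟩
  simpa using h

end Summit.QuantumFields.YangMills.Theorems.OrganTangentGradientFromAnalytic

end
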